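import Summits.SmoothPoincare4.SmoothPoincare4.Theorems.SymplecticOrigamiOrigamiFoldExistenceStubOuterCleanRecognitionGlue
import Summits.SmoothPoincare4.SmoothPoincare4.Theorems.SymplecticOrigamiOrigamiFoldExistenceStubCleanOnePleatIroningSide
import Literature.Topology.FourManifolds.SphereHypersurfaceSides

/-!
# Stub `stub_outerCleanRecognitionChart` of line `shadow-pleats` for crux `OrigamiFoldExistence` — B:
# TUBE COORDINATES of the chart shadow near the outer fold sphere (item stmt-SmoothPoincare4-7844, route SymplecticOrigami; seat c3, S4''-chart worker)

Second helper file towards `stub_outerCleanRecognitionChart : OuterCleanRecognitionChart`.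
The map `Φ : S⁴ → M` of that statement must be a smooth immersion ACROSS the lifted outer
crease `λ(c_out)`, `c_out = G(S(0,2))` (`G = proj5 ∘ ι ∘ e₀` the chart shadow), although the
shadow `G` FOLDS along `S(0,2)`: so `Φ` cannot be the inverse of `λ ∘ G` near the crease, and
the outer collar `G({2 ≤ |u| < 2 + κ})` has to be re-parametrised.  The re-parametrisation of
the later files is FIBREWISE with respect to a tubular neighbourhood of the lifted crease;
this file sets up the corresponding coordinates.  SETTING (abstract): `G : ℝ⁴ → ℝ⁴` smooth,
`f = λ ∘ radialSphere G 2 : S³ → S⁴` (the lifted crease; a smooth embedding when `G` is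
injective on `S(0,2)` with transverse fold kernels, `isSmoothEmbedding_liftS4_radialSphere`),
and tube data `D : TubeData f` of the tree (`Literature/…/SphereHypersurfaceSides`: a smooth
open embedding `τ : S³ × ℝ¹ → S⁴` with `τ(x, 0) = f x`).  For a chart point `u` whose lifted
shadow `λ(G u)` lies in the tube (`tubeDom D`, an open neighbourhood of `S(0,2)`):

* `tubeW D u ∈ S³`, `tubeT D u ∈ ℝ` — the core point and the fibre height of `λ(G u)`
  (`τ (tubeW D u, tubeT D u • e₀) = λ (G u)`, `τ_tubeW_tubeT`); on `S(0,2)`: `tubeW = u/2`,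
  `tubeT = 0`;
* `tubeV D u = ↑(tubeW D u) ∈ ℝ⁴` (a unit vector) and the ANGULAR STRAIGHTENING
  `str D u = ‖u‖ • tubeV D u` — norm-preserving (`norm_str`), the identity on `S(0,2)`
  (`str_of_norm`), smooth on `tubeDom D ∖ {0}` (`contDiffOn_str`), and with INJECTIVE
  DIFFERENTIAL at every point of `S(0,2)` (`injective_fderiv_str`: it fixes the sphere, so its
  differential is the identity on tangent vectors, and `‖str u‖² = ‖u‖²` forces
  `⟪u, d str(u) ξ⟫ = ⟪u, ξ⟫`).  In the coordinates `str`, the lifted shadow maps each radial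
  segment into ONE tube fibre (`λ (G u) = τ (str u / ‖u‖, tubeT u • e₀)`), which is what
  makes the fibrewise re-parametrisation of the collar possible (files C, D).

Sources: M. W. Hirsch, *Differential Topology* (1976), Ch. 4 §5–§6 (tubular neighbourhoods,
collars); the lead's `OuterClean-analysis-c3.md` §3 (O2)(c)–(d) ("Whitney collars").
-/

noncomputable section

-- the prescribed namespace `Summit.<P>.<Sub>.…` duplicates `SmoothPoincare4` (P = Sub)
set_option linter.dupNamespace false

open scoped Manifold ContDiff Topology RealInnerProductSpace
open Set Function Metric
open Literature.Topology.FourManifolds Literature.Topology.FourManifolds.SphereHypersurfaceSides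

namespace Summit.SmoothPoincare4.SmoothPoincare4.Theorems.OrigamiFoldExistence.ShadowPleats

/-! ### The lifted crease of an abstract chart shadow -/

section Abstract

variable {G : EuclideanSpace ℝ (Fin 4) → EuclideanSpace ℝ (Fin 4)}

/-- **The lifted crease `λ ∘ radialSphere G 2 : S³ → S⁴` is a smooth embedding** when `G` is
smooth, injective on `S(0,2)` and has transverse fold kernels there (abstract form of
`isSmoothEmbedding_liftedCrease`). [folklore] -/
theorem isSmoothEmbedding_liftS4_radialSphere (hG : ContDiff ℝ ∞ G) (hinj : InjOn G (Metric.sphere 0 2))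
    (hker : ∀ u w : EuclideanSpace ℝ (Fin 4), ‖u‖ = 2 → ⟪u, w⟫ = 0 → fderiv ℝ G u w = 0 → w = 0) :
    Manifold.IsSmoothEmbedding (𝓡 3) (𝓡 4) ∞ (liftS4 ∘ radialSphere G 2) := by
  have hc : Manifold.IsSmoothEmbedding (𝓡 3) (𝓡 4) ∞ (radialSphere G 2) :=
    isSmoothEmbedding_radialSphere hG two_pos hinj hker
  refine Literature.Topology.FourManifolds.isSmoothEmbedding_of_injective_of_injective_mfderiv
    (contMDiff_liftS4.comp hc.contMDiff) (by simp) (liftS4_injective.comp hc.isEmbedding.injective)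
    fun z => ?_
  have h1 : HasMFDerivAt (𝓡 3) (𝓡 4) (radialSphere G 2) z (mfderiv (𝓡 3) (𝓡 4) (radialSphere G 2) z) :=
    ((hc.contMDiff z).mdifferentiableAt (by simp)).hasMFDerivAt
  have h2 : HasMFDerivAt (𝓡 4) (𝓡 4) liftS4 (radialSphere G 2 z)
      (mfderiv (𝓡 4) (𝓡 4) liftS4 (radialSphere G 2 z)) :=
    ((contMDiff_liftS4 _).mdifferentiableAt (by simp)).hasMFDerivAt
  rw [(h2.comp z h1).mfderiv]
  intro a b hab
  exact Literature.Topology.FourManifolds.injective_mfderiv_of_isImmersionAt' (hc.isImmersion.isImmersionAt z)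
    (injective_mfderiv_liftS4 _ hab)

/-- The point `u/2 ∈ S³` under a point `u` of the fold sphere `S(0,2)`. -/
def halfPt (u : EuclideanSpace ℝ (Fin 4)) (hu : ‖u‖ = 2) : Metric.sphere (0 : EuclideanSpace ℝ (Fin 4)) 1 :=
  ⟨(2 : ℝ)⁻¹ • u, by rw [mem_sphere_zero_iff_norm, norm_smul, norm_inv, Real.norm_ofNat, hu]; norm_num⟩

/-- Coercion of `halfPt`. -/
@[simp] theorem coe_halfPt (u : EuclideanSpace ℝ (Fin 4)) (hu : ‖u‖ = 2) :
    (halfPt u hu : EuclideanSpace ℝ (Fin 4)) = (2 : ℝ)⁻¹ • u := rfl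

/-- The lifted crease at `u/2` is the lifted shadow of `u`. -/
theorem liftS4_radialSphere_halfPt (u : EuclideanSpace ℝ (Fin 4)) (hu : ‖u‖ = 2) :
    (liftS4 ∘ radialSphere G 2) (halfPt u hu) = liftS4 (G u) := by
  simp [radialSphere, smul_smul]

/-! ### Tube coordinates -/

variable (D : TubeData (liftS4 ∘ radialSphere G 2))

/-- The chart points whose lifted shadow lies in the tube of the lifted crease. -/
def tubeDom : Set (EuclideanSpace ℝ (Fin 4)) := (fun u => liftS4 (G u)) ⁻¹' range D.τ

/-- The CORE POINT (in `S³`) of the lifted shadow of `u`. -/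
def tubeW (u : EuclideanSpace ℝ (Fin 4)) : Metric.sphere (0 : EuclideanSpace ℝ (Fin 4)) 1 :=
  (D.chart.symm (liftS4 (G u))).1

/-- The FIBRE HEIGHT of the lifted shadow of `u`. -/
def tubeT (u : EuclideanSpace ℝ (Fin 4)) : ℝ := D.coord (liftS4 (G u))

/-- The core point as a unit vector of `ℝ⁴`. -/
def tubeV (u : EuclideanSpace ℝ (Fin 4)) : EuclideanSpace ℝ (Fin 4) := (tubeW D u : EuclideanSpace ℝ (Fin 4))

/-- The ANGULAR STRAIGHTENING `u ↦ ‖u‖ • tubeV u`. -/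
def str (u : EuclideanSpace ℝ (Fin 4)) : EuclideanSpace ℝ (Fin 4) := ‖u‖ • tubeV D u

/-- `tubeDom` is open (for continuous `G`). -/
theorem isOpen_tubeDom (hG : Continuous G) : IsOpen (tubeDom D) :=
  D.isOpen_range.preimage (contMDiff_liftS4.continuous.comp hG)

/-- On the fold sphere the lifted shadow is the core of the tube. -/
theorem liftS4_apply_eq_τ {u : EuclideanSpace ℝ (Fin 4)} (hu : ‖u‖ = 2) :
    liftS4 (G u) = D.τ (halfPt u hu, 0) := by
  rw [D.apply_zero, liftS4_radialSphere_halfPt]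

/-- The fold sphere lies in `tubeDom`. -/
theorem mem_tubeDom_of_norm {u : EuclideanSpace ℝ (Fin 4)} (hu : ‖u‖ = 2) : u ∈ tubeDom D := by
  show liftS4 (G u) ∈ range D.τ
  rw [liftS4_apply_eq_τ D hu]
  exact mem_range_self _

/-- `tubeDom` is a neighbourhood of every point of the fold sphere. -/
theorem tubeDom_mem_nhds (hG : Continuous G) {u : EuclideanSpace ℝ (Fin 4)} (hu : ‖u‖ = 2) :
    tubeDom D ∈ 𝓝 u :=
  (isOpen_tubeDom D hG).mem_nhds (mem_tubeDom_of_norm D hu)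

/-- On the fold sphere the core point is `u/2`. -/
theorem tubeW_of_norm {u : EuclideanSpace ℝ (Fin 4)} (hu : ‖u‖ = 2) : tubeW D u = halfPt u hu := by
  rw [tubeW, liftS4_apply_eq_τ D hu, D.chart_symm_apply]

/-- On the fold sphere the fibre height vanishes. -/
theorem tubeT_of_norm {u : EuclideanSpace ℝ (Fin 4)} (hu : ‖u‖ = 2) : tubeT D u = 0 := by
  rw [tubeT, liftS4_apply_eq_τ D hu, D.coord_apply]
  rfl

/-- On the fold sphere the unit vector is `u/2`. -/
theorem tubeV_of_norm {u : EuclideanSpace ℝ (Fin 4)} (hu : ‖u‖ = 2) : tubeV D u = (2 : ℝ)⁻¹ • u := by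
  rw [tubeV, tubeW_of_norm D hu, coe_halfPt]

/-- **The angular straightening fixes the fold sphere pointwise.** -/
theorem str_of_norm {u : EuclideanSpace ℝ (Fin 4)} (hu : ‖u‖ = 2) : str D u = u := by
  rw [str, tubeV_of_norm D hu, hu, smul_smul]; norm_num

/-- The unit vector is a unit vector. -/
@[simp] theorem norm_tubeV (u : EuclideanSpace ℝ (Fin 4)) : ‖tubeV D u‖ = 1 := norm_eq_of_mem_sphere _

/-- **The angular straightening preserves norms.** -/
@[simp] theorem norm_str (u : EuclideanSpace ℝ (Fin 4)) : ‖str D u‖ = ‖u‖ := by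
  rw [str, norm_smul, norm_norm, norm_tubeV, mul_one]

/-- The unit vector of a straightened point of positive norm. -/
theorem tubeV_eq_smul_str {u : EuclideanSpace ℝ (Fin 4)} (hu : u ≠ 0) : tubeV D u = ‖u‖⁻¹ • str D u := by
  rw [str, smul_smul, inv_mul_cancel₀ (norm_ne_zero_iff.2 hu), one_smul]

/-- The fibre component of the tube chart is the height times `e₀`. -/
theorem chart_symm_snd (z : Metric.sphere (0 : EuclideanSpace ℝ (Fin 5)) 1) :
    (D.chart.symm z).2 = (D.coord z) • SphereHypersurfaceSides.e₀ := by
  rw [TubeData.coord, smul_e₀_eq]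

/-- **Reconstruction**: in the tube, the lifted shadow of `u` is the tube point over
`tubeW u` at height `tubeT u`. -/
theorem τ_tubeW_tubeT {u : EuclideanSpace ℝ (Fin 4)} (hu : u ∈ tubeDom D) :
    D.τ (tubeW D u, tubeT D u • SphereHypersurfaceSides.e₀) = liftS4 (G u) := by
  have h1 : (tubeW D u, tubeT D u • SphereHypersurfaceSides.e₀) = D.chart.symm (liftS4 (G u)) := by
    rw [tubeW, tubeT, ← chart_symm_snd]
  rw [h1]
  have htarget : liftS4 (G u) ∈ D.chart.target := by rw [D.chart_target]; exact hu
  exact D.chart.right_inv htarget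

/-- Two chart points in `tubeDom` with the same core point and the same height have the same
shadow. -/
theorem apply_eq_of_tubeW_eq {u u' : EuclideanSpace ℝ (Fin 4)} (hu : u ∈ tubeDom D) (hu' : u' ∈ tubeDom D)
    (hW : tubeW D u = tubeW D u') (hT : tubeT D u = tubeT D u') : G u = G u' := by
  apply liftS4_injective
  rw [← τ_tubeW_tubeT D hu, ← τ_tubeW_tubeT D hu', hW, hT]

/-- Conversely, equal shadows give equal tube coordinates. -/
theorem tubeW_eq_of_apply_eq {u u' : EuclideanSpace ℝ (Fin 4)} (h : G u = G u') :
    tubeW D u = tubeW D u' ∧ tubeT D u = tubeT D u' := by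
  simp only [tubeW, tubeT, h, and_self]

/-! ### Smoothness of the tube coordinates -/

/-- The lifted shadow is smooth. -/
theorem contMDiff_liftS4_comp (hG : ContDiff ℝ ∞ G) :
    ContMDiff 𝓘(ℝ, EuclideanSpace ℝ (Fin 4)) (𝓡 4) ∞ fun u => liftS4 (G u) :=
  contMDiff_liftS4.comp hG.contMDiff

/-- The tube chart read through the lifted shadow is smooth on `tubeDom`. -/
theorem contMDiffOn_chart_symm_comp (hG : ContDiff ℝ ∞ G) :
    ContMDiffOn 𝓘(ℝ, EuclideanSpace ℝ (Fin 4)) ((𝓡 3).prod 𝓘(ℝ, EuclideanSpace ℝ (Fin 1))) ∞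
      (fun u => D.chart.symm (liftS4 (G u))) (tubeDom D) :=
  D.contMDiffOn_chart_symm.comp (contMDiff_liftS4_comp hG).contMDiffOn fun _ hu => hu

/-- The core point is smooth on `tubeDom` (as a map into `S³`). -/
theorem contMDiffOn_tubeW (hG : ContDiff ℝ ∞ G) :
    ContMDiffOn 𝓘(ℝ, EuclideanSpace ℝ (Fin 4)) (𝓡 3) ∞ (tubeW D) (tubeDom D) :=
  contMDiff_fst.comp_contMDiffOn (contMDiffOn_chart_symm_comp D hG)

/-- The unit vector is smooth on `tubeDom`. -/
theorem contDiffOn_tubeV (hG : ContDiff ℝ ∞ G) : ContDiffOn ℝ ∞ (tubeV D) (tubeDom D) := by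
  rw [← contMDiffOn_iff_contDiffOn]
  exact (contMDiff_coe_sphere (n := 3) (E := EuclideanSpace ℝ (Fin 4))).comp_contMDiffOn
    (contMDiffOn_tubeW D hG)

/-- The fibre height is smooth on `tubeDom`. -/
theorem contDiffOn_tubeT (hG : ContDiff ℝ ∞ G) : ContDiffOn ℝ ∞ (tubeT D) (tubeDom D) := by
  rw [← contMDiffOn_iff_contDiffOn]
  exact D.contMDiffOn_coord.comp (contMDiff_liftS4_comp hG).contMDiffOn fun _ hu => hu

/-- The angular straightening is smooth on `tubeDom ∖ {0}`. -/
theorem contDiffOn_str (hG : ContDiff ℝ ∞ G) : ContDiffOn ℝ ∞ (str D) (tubeDom D ∩ {u | u ≠ 0}) :=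
  ((contDiffOn_id.norm ℝ fun _ hu => hu.2).smul ((contDiffOn_tubeV D hG).mono inter_subset_left))

/-- The angular straightening is `C^∞` at every point of the fold sphere. -/
theorem contDiffAt_str (hG : ContDiff ℝ ∞ G) {u : EuclideanSpace ℝ (Fin 4)} (hu : ‖u‖ = 2) :
    ContDiffAt ℝ ∞ (str D) u := by
  have hu0 : u ≠ 0 := by rw [← norm_ne_zero_iff, hu]; norm_num
  refine (contDiffOn_str D hG).contDiffAt (Filter.inter_mem (tubeDom_mem_nhds D hG.continuous hu) ?_)
  exact isOpen_ne.mem_nhds hu0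

/-- The fibre height is `C^∞` at every point of the fold sphere. -/
theorem contDiffAt_tubeT (hG : ContDiff ℝ ∞ G) {u : EuclideanSpace ℝ (Fin 4)} (hu : ‖u‖ = 2) :
    ContDiffAt ℝ ∞ (tubeT D) u :=
  (contDiffOn_tubeT D hG).contDiffAt (tubeDom_mem_nhds D hG.continuous hu)

end Abstract

/-! ### The differential of the angular straightening on the fold sphere -/

/-- **The angular straightening has injective differential at every point of the fold
sphere**: it fixes the sphere pointwise (so `d str(u)` is the identity on `uᗮ`,
`fderiv_apply_eq_self_of_sphere_fix`) and preserves norms (so `⟪u, d str(u) ξ⟫ = ⟪u, ξ⟫`).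
[folklore] -/
theorem injective_fderiv_str {G : EuclideanSpace ℝ (Fin 4) → EuclideanSpace ℝ (Fin 4)} (D : TubeData (liftS4 ∘ radialSphere G 2)) (hG : ContDiff ℝ ∞ G) {u : EuclideanSpace ℝ (Fin 4)} (hu : ‖u‖ = 2) : Injective (fderiv ℝ (str D) u) := by
  have hu0 : u ≠ 0 := by rw [← norm_ne_zero_iff, hu]; norm_num
  have hdiff : DifferentiableAt ℝ (str D) u := (contDiffAt_str D hG hu).differentiableAt (by simp)
  -- (a) `str` fixes the sphere `S(0,2)` pointwise
  have hfix : ∀ᶠ u' in 𝓝 u, ‖u'‖ = ‖u‖ → str D u' = u' :=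
    Filter.Eventually.of_forall fun u' hu' => str_of_norm D (hu'.trans hu)
  -- (b) `‖str ·‖² = ‖·‖²`, differentiated at `u`
  have h1 : HasFDerivAt (fun u' => ‖str D u'‖ ^ 2)
      (2 • (innerSL ℝ (str D u)).comp (fderiv ℝ (str D) u)) u := hdiff.hasFDerivAt.norm_sq
  have hfun : (fun u' => ‖str D u'‖ ^ 2) = fun u' : EuclideanSpace ℝ (Fin 4) => ‖u'‖ ^ 2 :=
    funext fun u' => by rw [norm_str]
  rw [hfun] at h1
  have heq := h1.unique (hasStrictFDerivAt_norm_sq u).hasFDerivAt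
  intro ξ₁ ξ₂ hξ
  have hξ0 : fderiv ℝ (str D) u (ξ₁ - ξ₂) = 0 := by rw [map_sub, hξ, sub_self]
  have hinner : ⟪u, ξ₁ - ξ₂⟫ = 0 := by
    have h := congrArg (fun L : EuclideanSpace ℝ (Fin 4) →L[ℝ] ℝ => L (ξ₁ - ξ₂)) heq
    have h' : (2 : ℕ) • ⟪str D u, fderiv ℝ (str D) u (ξ₁ - ξ₂)⟫ = (2 : ℕ) • ⟪u, ξ₁ - ξ₂⟫ := h
    rw [hξ0, inner_zero_right, smul_zero, two_nsmul] at h'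
    linarith
  have htan := fderiv_apply_eq_self_of_sphere_fix hu0 hdiff hfix hinner
  rw [hξ0] at htan
  exact sub_eq_zero.1 htan.symm

end Summit.SmoothPoincare4.SmoothPoincare4.Theorems.OrigamiFoldExistence.ShadowPleats

end
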